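import Mathlib
import HarnessLib
import Literature.MathematicalPhysics.KineticTheory.VelocityFlipNoise
import Summits.AtomisticToContinuum.FouriersLaw.Theorems.OddSectorIrreversibilityResponseDensityGibbsTranspose

/-!
# Smooth distributional solutions of the flip-noisy equation are classical (dual Kubo road: glue for clause (i))

`--supports stmt-AtomisticToContinuum-11976` helper file (crux `VanishingNoiseBound`, route
`VanishingNoiseTransfer`, line `fekete-usc-one-length`, stub S3' `stub_flipForwardFieldRegularity`, wave 4).
Clause (i) of the corrected hypothesis `FF''(ε)` of the dual Kubo road (`…FlipDualKuboLink`) asks for a CLASSICAL `C²`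
forward field of `L_{T,T} + εS`; the mild forward field is a DISTRIBUTIONAL solution (`…FlipMildDistributional`), so
clause (i) is its hypoelliptic `C^∞`-regularity PLUS the elementary passage proved here: a SMOOTH distributional
solution is a classical one. For an oscillator chain with smooth potentials, `N ≥ 1`, `γT_L, γT_R ≥ 0`, any `ε`:

* `revGenerator_eq_neg_generator_add'` — the bridge `L̂φ = −Lφ + 2γ(T_L ∂²_{p_0}φ + T_R ∂²_{p_{N−1}}φ)`
  (`L̂ = sdeGenerator (−Y) v_L v_R`, `ᵀL = L̂ + 2γ` the Lebesgue transpose of the generator `L`).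
* `flip_classical_of_weak_smooth` — if `u ∈ C^∞`, `F` is continuous and
  `∫ u · (−Lφ + 2γ(T_L ∂²_{p_0}φ + T_R ∂²_{p_{N−1}}φ) + 2γφ + εSφ) dx = ∫ F φ dx` for every `φ ∈ C_c^∞`, then
  `L u + εS u = F` POINTWISE (`langevin_integral_revGenerator_mul`, symmetry of `S` for Lebesgue measure,
  `ae_eq_zero_of_integral_contDiff_smul_eq_zero`, continuity).
* `helper_flipWeakToClassical` — registered helper (notation-free restatement for the pinned chain).
-/

noncomputable section

open MeasureTheory ProbabilityTheory Filter Topology Set Function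
open scoped ContDiff NNReal ENNReal
open Literature.MathematicalPhysics.KineticTheory.HeatConduction
open Literature.MathematicalPhysics.KineticTheory Literature.Probability.Process OscillatorChain

namespace Summit.AtomisticToContinuum.FouriersLaw.Theorems.VanishingNoiseBound

variable {N : ℕ}

/-- The bath second-order part: `Σ_i ([i=0]T_L + [i=N−1]T_R) ∂²_{p_i} f = T_L ∂²_{p_0} f + T_R ∂²_{p_{N−1}} f`
(`N ≥ 1`). -/
theorem sum_bathTemps_mul_partialP' (hN : 0 < N) (T_L T_R : ℝ) (f : PhaseSpace N → ℝ) (x : PhaseSpace N) :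
    (∑ i : Fin N, ((if i.val = 0 then T_L else 0) + (if i.val = N - 1 then T_R else 0)) *
        partialP i (partialP i f) x) =
      T_L * partialP (⟨0, hN⟩ : Fin N) (partialP (⟨0, hN⟩ : Fin N) f) x +
        T_R * partialP (⟨N - 1, Nat.sub_lt hN one_pos⟩ : Fin N)
          (partialP (⟨N - 1, Nat.sub_lt hN one_pos⟩ : Fin N) f) x := by
  simp only [add_mul, Finset.sum_add_distrib, ite_mul, zero_mul]
  congr 1
  · rw [Finset.sum_eq_single ⟨0, hN⟩]
    · simp
    · intro i _ hi
      have : i.val ≠ 0 := fun h => hi (Fin.ext h)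
      simp [this]
    · intro h; exact absurd (Finset.mem_univ _) h
  · rw [Finset.sum_eq_single ⟨N - 1, Nat.sub_lt hN one_pos⟩]
    · simp
    · intro i _ hi
      have : i.val ≠ N - 1 := fun h => hi (Fin.ext h)
      simp [this]
    · intro h; exact absurd (Finset.mem_univ _) h

/-- **The bridge `L̂φ = −Lφ + 2γ(T_L ∂²_{p_0}φ + T_R ∂²_{p_{N−1}}φ)`** for an oscillator chain `P`, `N ≥ 1`,
`γT_L, γT_R ≥ 0`, `φ ∈ C²`. -/
theorem revGenerator_eq_neg_generator_add' (P : OscillatorChain) (hN : 0 < N) {T_L T_R : ℝ}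
    (hL : 0 ≤ P.γ * T_L) (hR : 0 ≤ P.γ * T_R) {φ : PhaseSpace N → ℝ} (hφ : ContDiff ℝ 2 φ) (x : PhaseSpace N) :
    sdeGenerator (fun y => -P.drift N y) (P.bathVecL N T_L) (P.bathVecR N T_R) φ x =
      -(P.generator N T_L T_R φ x) +
        2 * P.γ * (T_L * partialP (⟨0, hN⟩ : Fin N) (partialP (⟨0, hN⟩ : Fin N) φ) x +
          T_R * partialP (⟨N - 1, Nat.sub_lt hN one_pos⟩ : Fin N)
            (partialP (⟨N - 1, Nat.sub_lt hN one_pos⟩ : Fin N) φ) x) := by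
  have h1 := generator_eq_fderiv_add_half P hN hL hR hφ x
  have h2 := P.generator_eq_fderiv_drift_add N T_L T_R (hφ.differentiable (by norm_num)) x
  rw [sum_bathTemps_mul_partialP' hN] at h2
  rw [sdeGenerator_def, map_neg]
  show -(fderiv ℝ φ x) (P.drift N x) + 1 / 2 * ((fderiv ℝ (fderiv ℝ φ) x) (bathVec N 0 (Real.sqrt (2 * P.γ * T_L)))
      (bathVec N 0 (Real.sqrt (2 * P.γ * T_L))) + (fderiv ℝ (fderiv ℝ φ) x) (bathVec N (N - 1) (Real.sqrt (2 * P.γ * T_R)))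
      (bathVec N (N - 1) (Real.sqrt (2 * P.γ * T_R)))) = _
  linarith [h1, h2]

/-- **Smooth distributional solutions of `(L_{T_L,T_R} + εS) u = F` are classical.** See the module docstring. -/
theorem flip_classical_of_weak_smooth (P : OscillatorChain) (hU : ContDiff ℝ ∞ P.U) (hV : ContDiff ℝ ∞ P.V)
    (hN : 0 < N) {T_L T_R : ℝ} (hL : 0 ≤ P.γ * T_L) (hR : 0 ≤ P.γ * T_R) (ε : ℝ)
    {u F : PhaseSpace N → ℝ} (hu : ContDiff ℝ ∞ u) (hF : Continuous F)
    (hweak : ∀ φ : PhaseSpace N → ℝ, ContDiff ℝ ∞ φ → HasCompactSupport φ →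
      ∫ x, u x * (-(P.generator N T_L T_R φ x) +
          2 * P.γ * (T_L * partialP (⟨0, hN⟩ : Fin N) (partialP (⟨0, hN⟩ : Fin N) φ) x +
            T_R * partialP (⟨N - 1, Nat.sub_lt hN one_pos⟩ : Fin N)
              (partialP (⟨N - 1, Nat.sub_lt hN one_pos⟩ : Fin N) φ) x) +
          2 * P.γ * φ x + ε * flipNoise N φ x) = ∫ x, F x * φ x) :
    ∀ x, P.generator N T_L T_R u x + ε * flipNoise N u x = F x := by
  haveI := isAddHaarMeasure_volume_phaseSpace N
  have huc : Continuous u := hu.continuous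
  have hLuc : Continuous (P.generator N T_L T_R u) :=
    P.continuous_generator (hU.of_le (by norm_cast)) (hV.of_le (by norm_cast)) N T_L T_R (hu.of_le (by norm_cast))
  have hSuc : Continuous (flipNoise N u) := by
    have : flipNoise N u = fun x => ∑ i : Fin N, (u (momentumFlip i x) - u x) := by
      funext x; rw [flipNoise_eq]
    rw [this]
    exact continuous_finsetSum _ fun i _ => (huc.comp (continuous_momentumFlip i)).sub huc
  set G : PhaseSpace N → ℝ := fun x => P.generator N T_L T_R u x + ε * flipNoise N u x - F x with hG
  have hGc : Continuous G := by rw [hG]; fun_prop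
  -- `∫ G φ = 0` for every test function
  have hGφ : ∀ φ : PhaseSpace N → ℝ, ContDiff ℝ ∞ φ → HasCompactSupport φ → ∫ x, φ x • G x = 0 := by
    intro φ hφ hφc
    have hφc' : Continuous φ := hφ.continuous
    have hφ2 : ContDiff ℝ 2 φ := hφ.of_le (by norm_cast)
    -- products of compactly supported continuous functions with continuous ones are integrable
    have hint : ∀ {a b : PhaseSpace N → ℝ}, Continuous a → HasCompactSupport a → Continuous b →
        Integrable (fun x => a x * b x) := fun ha has hb => (ha.mul hb).integrable_of_hasCompactSupport has.mul_right
    have hint' : ∀ {a b : PhaseSpace N → ℝ}, Continuous a → HasCompactSupport a → Continuous b →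
        Integrable (fun x => b x * a x) := fun ha has hb => (hb.mul ha).integrable_of_hasCompactSupport has.mul_left
    -- the transposed generator part: `∫ u ᵀLφ = ∫ φ Lu`
    have h1 := langevin_integral_revGenerator_mul P hU hV hN hL hR hφ hφc hu
    -- the flip part: `∫ u Sφ = ∫ (Su) φ`
    have hφFc : ∀ i : Fin N, HasCompactSupport fun x => φ (momentumFlip i x) := by
      intro i
      let e : PhaseSpace N ≃ₜ PhaseSpace N :=
        { toFun := momentumFlip i, invFun := momentumFlip i, left_inv := momentumFlip_momentumFlip i,
          right_inv := momentumFlip_momentumFlip i, continuous_toFun := continuous_momentumFlip i,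
          continuous_invFun := continuous_momentumFlip i }
      exact hφc.comp_homeomorph e
    have h2 : ∫ x, u x * flipNoise N φ x = ∫ x, flipNoise N u x * φ x :=
      integral_mul_flipNoise (fun i => measurePreserving_momentumFlip_volume i) (hint' hφc' hφc huc)
        fun i => hint' (hφc'.comp (continuous_momentumFlip i)) (hφFc i) huc
    -- assemble
    have hw := hweak φ hφ hφc
    have e1 : ∀ x, u x * (-(P.generator N T_L T_R φ x) +
        2 * P.γ * (T_L * partialP (⟨0, hN⟩ : Fin N) (partialP (⟨0, hN⟩ : Fin N) φ) x +
          T_R * partialP (⟨N - 1, Nat.sub_lt hN one_pos⟩ : Fin N)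
            (partialP (⟨N - 1, Nat.sub_lt hN one_pos⟩ : Fin N) φ) x) +
        2 * P.γ * φ x + ε * flipNoise N φ x) =
        (sdeGenerator (fun y => -P.drift N y) (P.bathVecL N T_L) (P.bathVecR N T_R) φ x + 2 * P.γ * φ x) * u x +
          ε * (u x * flipNoise N φ x) := by
      intro x; rw [revGenerator_eq_neg_generator_add' P hN hL hR hφ2 x]; ring
    have hTLc : Continuous fun x => sdeGenerator (fun y => -P.drift N y) (P.bathVecL N T_L) (P.bathVecR N T_R) φ x +
        2 * P.γ * φ x :=
      (continuous_sdeGenerator _ _ (P.contDiff_drift hU hV N).continuous.neg hφ2).add (continuous_const.mul hφc')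
    have hTLs : HasCompactSupport fun x => sdeGenerator (fun y => -P.drift N y) (P.bathVecL N T_L) (P.bathVecR N T_R) φ x +
        2 * P.γ * φ x := (hasCompactSupport_sdeGenerator _ _ hφc).add hφc.mul_left
    have iSφ : Integrable fun x => u x * flipNoise N φ x := by
      have : (fun x => u x * flipNoise N φ x) = fun x => ∑ i : Fin N, (u x * φ (momentumFlip i x) - u x * φ x) := by
        funext x; rw [flipNoise_eq, Finset.mul_sum]; simp only [mul_sub]
      rw [this]
      exact integrable_finsetSum _ fun i _ =>
        (hint' (hφc'.comp (continuous_momentumFlip i)) (hφFc i) huc).sub (hint' hφc' hφc huc)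
    rw [integral_congr_ae (ae_of_all _ e1), integral_add (hint hTLc hTLs huc) (iSφ.const_mul ε),
      integral_const_mul, h1, h2] at hw
    -- `hw : ∫ φ Lu + ε ∫ (Su) φ = ∫ F φ`
    have iLu := hint' hφc' hφc hLuc
    have iSu := hint' hφc' hφc hSuc
    have iF := hint' hφc' hφc hF
    have e2 : ∀ x, φ x • G x = φ x * P.generator N T_L T_R u x + ε * (flipNoise N u x * φ x) - F x * φ x := by
      intro x; rw [hG, smul_eq_mul]; ring
    have i12 : Integrable fun x => φ x * P.generator N T_L T_R u x + ε * (flipNoise N u x * φ x) :=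
      (hint hφc' hφc hLuc).add (iSu.const_mul ε)
    rw [integral_congr_ae (ae_of_all _ e2), integral_sub i12 iF,
      integral_add (hint hφc' hφc hLuc) (iSu.const_mul ε), integral_const_mul]
    linarith
  have hae : ∀ᵐ x ∂(volume : Measure (PhaseSpace N)), G x = 0 :=
    ae_eq_zero_of_integral_contDiff_smul_eq_zero hGc.locallyIntegrable hGφ
  have hzero : G = fun _ => 0 := (hGc.ae_eq_iff_eq volume continuous_const).1 hae
  intro x
  have := congrFun hzero x
  rw [hG] at this
  dsimp only at this
  linarith

/-! ## Registered helper -/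

/-- Registered helper sub-goal `helper_flipWeakToClassical` of stub `stub_flipForwardFieldRegularity` (line
`fekete-usc-one-length`, crux stmt-AtomisticToContinuum-11976): smooth distributional solutions of the flip-noisy
equation are classical (`flip_classical_of_weak_smooth`). -/
theorem helper_flipWeakToClassical : ∀ (N : ℕ) (P : Literature.MathematicalPhysics.KineticTheory.HeatConduction.OscillatorChain), ContDiff ℝ ((⊤ : ℕ∞) : WithTop ℕ∞) P.U → ContDiff ℝ ((⊤ : ℕ∞) : WithTop ℕ∞) P.V → ∀ (hN : 0 < N) (T_L T_R : ℝ), 0 ≤ P.γ * T_L → 0 ≤ P.γ * T_R → ∀ (ε : ℝ) (u F : Literature.MathematicalPhysics.KineticTheory.HeatConduction.PhaseSpace N → ℝ), ContDiff ℝ ((⊤ : ℕ∞) : WithTop ℕ∞) u → Continuous F → (∀ φ : Literature.MathematicalPhysics.KineticTheory.HeatConduction.PhaseSpace N → ℝ, ContDiff ℝ ((⊤ : ℕ∞) : WithTop ℕ∞) φ → HasCompactSupport φ → MeasureTheory.integral MeasureTheory.volume (fun x => u x * (-(P.generator N T_L T_R φ x) + 2 * P.γ * (T_L * Literature.MathematicalPhysics.KineticTheory.HeatConduction.partialP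 (⟨0, hN⟩ : Fin N) (Literature.MathematicalPhysics.KineticTheory.HeatConduction.partialP (⟨0, hN⟩ : Fin N) φ) x + T_R * Literature.MathematicalPhysics.KineticTheory.HeatConduction.partialP (⟨N - 1, Nat.sub_lt hN one_pos⟩ : Fin N) (Literature.MathematicalPhysics.KineticTheory.HeatConduction.partialP (⟨N - 1, Nat.sub_lt hN one_pos⟩ : Fin N) φ) x) + 2 * P.γ * φ x + ε * Literature.MathematicalPhysics.KineticTheory.HeatConduction.flipNoise N φ x)) = MeasureTheory.integral MeasureTheory.volume (fun x => F x * φ x)) → ∀ x, P.generator N T_L T_R u x + ε * Literature.MathematicalPhysics.KineticTheory.HeatConduction.flipNoise N u x = F x :=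
  fun _ P hU hV hN _ _ hL hR ε _ _ hu hF hweak => flip_classical_of_weak_smooth P hU hV hN hL hR ε hu hF hweak

end Summit.AtomisticToContinuum.FouriersLaw.Theorems.VanishingNoiseBound

end
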